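import Summits.QuantumFields.YangMills.Theorems.FluctuationComparisonRegPrIntLWreg
import Summits.QuantumFields.YangMills.Theorems.FluctuationComparisonRegPrIntLHaarTubeLscFloor
import Summits.QuantumFields.YangMills.Theorems.FluctuationComparisonRegPrIntLHaarTubeOneStep
import Summits.QuantumFields.YangMills.Theorems.FluctuationComparisonRegPrIntLSupTailDepthInduction
import HarnessLib

/-!
# ⟨HAAR-TUBE₁-REL⟩ UNCONDITIONALLY: the window chart of the one-step descent charges EVERY neighbourhood of a good fibre point, hence every link-tube
# around a margin section, with ONE fraction over the closed window (stmt-QuantumFields-20520 helper; seat ym3-torus-px20 g11)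

Context.  LEAD w3-20520 g18's σ-free knit (✓`…SectionTubeSplit` ∕ ✓`…PersistenceSigmaFree`) reduces PERS₁∘ to ⟨UP⟩ + ⟨LOW on S′⟩ + ⟨SMALL-MASS₁(S′)⟩; px8 g14's
(A1″) knit `…SmallMassOneStep.smallMassInterior_of_haarTubeRel_floor (hrel) (hfloor)` reduces ⟨SMALL-MASS₁(S′)⟩ to two `K`-free letters: `hfloor` =
✓`…HaarFloorDepthOne.haarFloor_histGood_depthOne` (px20 g11) and `hrel` = ⟨HAAR-TUBE₁-REL⟩ = THIS FILE's `haarTubeRel_depthOne` (§3), verbatim.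

Mathematics ([Balaban1987RG1] (0.4) p.253, (2.10) p.267; [Balaban1985Averaging] (10) p.19, Prop. 1 p.22).  The one-step descent `D = D_{J,J+1}` restricted to the
UV-small history `Sfine = histGood(θ) (J+1) J` over the open window `O = {PlaqSmall θ_J}` carries WREG's WINDOW CHART (✓`…WregAssembly`: `ChartData`,
`WindowChart.ofChartData`, fed by ✓`Wreg.chartVol ∕ edgeFlat ∕ levelFlat`): `dU_{J+1}|(D⁻¹O ∩ Sfine) = Φ_*(jac · (dU_J|O ⊗ dU_{J+1}))`.  §1 LOCALISES the charge row
✓`…WregChartCharge.chartCharge_holds` (parametric solvability ✓`map_nhds_iterExtend_eq`): the environments whose off-pivot coordinates extend INTO ANY neighbourhood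
`S` of a good fibre point on the leaf `{Ū = W}` have positive product-Haar measure.  §2 adds the RECOGNITION row of `ChartData` ⇒ the LOCAL CHARGE
`∀ V ∈ O, ∀ x ∈ Sfine, D x = V → ∀ S ∈ 𝓝 x, S ⊆ Sfine → 0 < dU_{J+1}{z | c.jac(V,z) ≠ 0 ∧ c.Φ(V,z) ∈ S}`.  §3: for a section `σ` of `D` over `W_J(c·b₀)` with
margin (`PlaqSmall (θ_{J+1}(c·b₀) − 4r) (σ U)`, as GEOM∘ ✓`interiorSectionCan` supplies) the pairs `(U, σ U)` lie in the COMPACT set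
`P = {(D x, x) | plaq x ≤ θ_{J+1}(c b₀) − 4r, plaq (D x) ≤ θ_J(c b₀)}` (`D` continuous on the small class), where the tube charge is positive (§2 at the open
`S := Sfine ∩ tube_r(x)`: ✓`isOpen_histGood`, ✓`isOpen_linkTube`); w4-20520 g18's l.s.c.∕compactness engine ✓`…HaarTubeLscFloor.hfib_of_pos` gives ONE `q₁ > 0`, px8 g14's
door ✓`…HaarTubeOneStep.haarTube_oneStep_of_windowChart` integrates: `ofReal q₁·dU_{J+1}(D⁻¹B ∩ Sfine) ≤ dU_{J+1}(D⁻¹B ∩ Sfine ∩ T_σ)` for measurable `B ⊆ W_J(c·b₀)`.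

HONEST SCOPE.  Def-free, sorry-free; `K`-free statements at depth one.  Nothing `K`-uniform (⟨UP⟩∕⟨LOW⟩ = [Balaban1985UV3] (5)–(7)) is touched; ⟨SMALL-MASS₁⟩ ∕
PERS₁∘ ∕ TUBE∘ ∕ the crux `FluctuationComparisonRegPrIntL` (stmt-QuantumFields-20520) ∕ `YM3TorusSU2` are NOT proved here; rung R3 = SU(2) YM₃ on T³ — NOT d = 4,
NOT infinite volume, NOT a mass gap, NOT Clay.  References: T. Bałaban, CMP 109 (1987) 249–301 [Balaban1987RG1]; CMP 98 (1985) 17–51 [Balaban1985Averaging];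
CMP 102 (1985) 255–275 [Balaban1985UV3].
-/

noncomputable section

set_option autoImplicit false

open MeasureTheory Filter Topology Set Function
open scoped ENNReal NNReal
open Literature.MathematicalPhysics.QuantumFieldTheory.Balaban1983to89
open Literature.MathematicalPhysics.QuantumFieldTheory.Balaban1983to89.T3ContinuumYM3Torus
open Literature.MathematicalPhysics.QuantumFieldTheory.Balaban1983to89.T3NestedUnitLaws
open Literature.MathematicalPhysics.QuantumFieldTheory.Balaban1983to89.T3UnitLawDensityEML
open Literature.MathematicalPhysics.QuantumFieldTheory.Balaban1983to89.T3UnitScaleTilt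
open Literature.MathematicalPhysics.QuantumFieldTheory.Balaban1983to89.T3TiltDescent
open Literature.MathematicalPhysics.QuantumFieldTheory.Balaban1983to89.T3LevelShift
open Literature.MathematicalPhysics.QuantumFieldTheory.Balaban1983to89.T3Thresholds
open Literature.MathematicalPhysics.QuantumFieldTheory.Balaban1983to89.T3InteriorExcision (θBal_mul)
open Literature.MathematicalPhysics.QuantumFieldTheory.Balaban1983to89.ExpMeanLog (expMeanLogSU deltaSU)
open Literature.MathematicalPhysics.QuantumFieldTheory.Balaban1983to89.BlockAveraging (Idx avgFun loopHol Small)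
open Literature.MathematicalPhysics.QuantumFieldTheory.Balaban1983to89.BlockAveragingHaarAC (centralBond centralBond_injective)
open Literature.MathematicalPhysics.QuantumFieldTheory.Balaban1983to89.BlockAveragingEMLHaarAC (offCard)
open Literature.MathematicalPhysics.QuantumFieldTheory.Balaban1983to89.LatticeWordStokes (dist1_loopHol_le)
open Literature.MathematicalPhysics.QuantumFieldTheory.Balaban1983to89.B12ContinuousTransportInvariance (isOpenPosMeasure_fieldMeasure_SU)
open scoped Literature.MathematicalPhysics.QuantumFieldTheory.Balaban1983to89.T3OrbitAverage
open Summit.QuantumFields.YangMills.Theorems.FluctuationComparisonRegPrIntLWregChain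
open Summit.QuantumFields.YangMills.Theorems.FluctuationComparisonRegPrIntLWregFibredChart
open Summit.QuantumFields.YangMills.Theorems.FluctuationComparisonRegPrIntLWregGlue
open Summit.QuantumFields.YangMills.Theorems.FluctuationComparisonRegPrIntLWregInterior
open Summit.QuantumFields.YangMills.Theorems.FluctuationComparisonRegPrIntLWregAssembly
open Summit.QuantumFields.YangMills.Theorems.FluctuationComparisonRegPrIntLWregChartCharge
open Summit.QuantumFields.YangMills.Theorems.FluctuationComparisonRegPrIntLWreg (chartVol edgeFlat levelFlat)
open Summit.QuantumFields.YangMills.Theorems.FluctuationComparisonRegPrIntLHaarTubeLscFloor (isOpen_linkTube measurable_tubeIntegrand hfib_of_pos)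
open Summit.QuantumFields.YangMills.Theorems.FluctuationComparisonRegPrIntLHaarTubeOneStep (haarTube_oneStep_of_windowChart)
open Summit.QuantumFields.YangMills.Theorems.FluctuationComparisonRegPrIntLSupTailDepthInduction (plaqSmall_descendTo_iff mem_histGood_iff_descendTo)

namespace Summit.QuantumFields.YangMills.Theorems.FluctuationComparisonRegPrIntLHaarTubeLocalCharge

/-! ## §1 The charge row LOCALISED: every neighbourhood of a good fibre point on the leaf is charged -/

section Charge

/-- ★★ **LOCALISED CHARGE** (✓`…WregChartCharge.chartCharge_holds` with `interior histGood` replaced by an arbitrary neighbourhood): in the chart regime, for a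
UV-small history `U₀ ∈ histGood F ℰp θ K J` on the leaf `{Ū⁽ᴷ⁻ᴶ⁾ = W}` and ANY `S ∈ 𝓝 U₀`, the environments `z` whose off-pivot coordinates extend by some pivot values
`g` to a point of `S` on that leaf have POSITIVE product-Haar measure.  PROOF = the original one: all intermediate averages of `U₀` are `α`-loop-small
(✓`dist1_loopHol_le`), so `(z, g) ↦ (z, Ū(extend β g z))` maps `𝓝 (U₀, U₀ ∘ β)` onto `𝓝 (U₀, W)` (✓`map_nhds_iterExtend_eq`); the preimage of `S` under the continuous
`(z,g) ↦ extend β g z` is a neighbourhood of `(U₀, U₀ ∘ β)` (✓`extend_comp_self`), its image one of `(U₀, W)`, whose slice at `W` lies in the target; product Haar charges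
neighbourhoods (✓`isOpenPosMeasure_fieldMeasure_SU`).  [cite: Balaban1987RG1, (0.4) p.253 and (2.10) p.267; Balaban1985Averaging, (10) p.19; Balaban1985UV3, (7) p.257] -/
theorem chartChargeNhds_holds (β : ∀ (P : Params) (n : ℕ), PBond P n → PBond P 0)
    (hβ0 : ∀ (P : Params) (c : PBond P 0), β P 0 c = c)
    (hβs : ∀ (P : Params) (n : ℕ) (c : PBond P (n + 1)), β P (n + 1) c = β P n (centralBond c)) :
  ∀ (F : T3Family) (K J : ℕ) (θ : ℕ → ℝ) (α : ℝ), (∀ i, 0 ≤ θ i) → 0 < α → α ≤ 1 / 24 → 64 * α ≤ deltaSU (Fin 2) →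
    157 * α < (((F.P K).L : ℝ) ^ ((F.P K).d - 1))⁻¹ →
    (∀ i, (((((F.P K).d + 2) * (F.P K).L : ℕ) : ℝ) ^ 2 / 4) * θ i ≤ α) →
    ∀ (W : GaugeField (F.P K) (K - J) (Matrix.specialUnitaryGroup (Fin 2) ℂ)) (U₀ : GaugeField (F.P K) 0 (Matrix.specialUnitaryGroup (Fin 2) ℂ)),
      U₀ ∈ histGood F ℰp θ K J →
      Averaging.iter (fun i => BlockAveraging.blockAvg (P := F.P K) (j := i) ℰp) (K - J) U₀ = W →
      ∀ S : Set (GaugeField (F.P K) 0 (Matrix.specialUnitaryGroup (Fin 2) ℂ)), S ∈ 𝓝 U₀ →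
      0 < fieldMeasure (F.P K) 0 (Matrix.specialUnitaryGroup (Fin 2) ℂ)
        {z | ∃ g : PBond (F.P K) (K - J) → Matrix.specialUnitaryGroup (Fin 2) ℂ,
          Function.extend (β (F.P K) (K - J)) g z ∈ S ∧
          Averaging.iter (fun i => BlockAveraging.blockAvg (P := F.P K) (j := i) ℰp) (K - J)
            (Function.extend (β (F.P K) (K - J)) g z) = W} := by
  intro F K J θ α hθ0 hα0 hα24 hα64 hαL hθα W U₀ hU₀good hW S hS
  have hαδ : α < deltaSU (Fin 2) := by linarith
  have hKeq : (F.P K).K = K := rfl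
  have hn : K - J ≤ (F.P K).m + (F.P K).K := by rw [hKeq]; omega
  have hsmall : ∀ k, k < K - J → ∀ (c' : PBond (F.P K) (k + 1)) (i : Idx (F.P K)),
      dist1 (loopHol (Averaging.iter (fun i => BlockAveraging.blockAvg (P := F.P K) (j := i) ℰp) k U₀) c' i) ≤ α := by
    intro k hk c' i
    have hps : PlaqSmall (θ (K - k)) (Averaging.iter (fun i => BlockAveraging.blockAvg (P := F.P K) (j := i) ℰp) k U₀) := hU₀good k (by omega)
    exact (dist1_loopHol_le (hθ0 _) hps c' i).trans (hθα _)
  have hmap := map_nhds_iterExtend_eq (N := 2) β hβ0 hβs hα24 hαδ hαL hn U₀ hsmall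
  have hcont : Continuous fun q : GaugeField (F.P K) 0 (Matrix.specialUnitaryGroup (Fin 2) ℂ) × (PBond (F.P K) (K - J) → Matrix.specialUnitaryGroup (Fin 2) ℂ) =>
      Function.extend (β (F.P K) (K - J)) q.2 q.1 := by
    refine continuous_pi fun b => ?_
    by_cases hb : ∃ c, β (F.P K) (K - J) c = b
    · have hfun : (fun q : GaugeField (F.P K) 0 (Matrix.specialUnitaryGroup (Fin 2) ℂ) × (PBond (F.P K) (K - J) → Matrix.specialUnitaryGroup (Fin 2) ℂ) =>
          Function.extend (β (F.P K) (K - J)) q.2 q.1 b) = fun q => q.2 (Classical.choose hb) := by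
        funext q; rw [Function.extend_def, dif_pos hb]
      rw [hfun]; exact (continuous_apply _).comp continuous_snd
    · have hfun : (fun q : GaugeField (F.P K) 0 (Matrix.specialUnitaryGroup (Fin 2) ℂ) × (PBond (F.P K) (K - J) → Matrix.specialUnitaryGroup (Fin 2) ℂ) =>
          Function.extend (β (F.P K) (K - J)) q.2 q.1 b) = fun q => q.1 b := by
        funext q; rw [Function.extend_apply' _ _ _ hb]
      rw [hfun]; exact (continuous_apply _).comp continuous_fst
  have hpre : (fun q : GaugeField (F.P K) 0 (Matrix.specialUnitaryGroup (Fin 2) ℂ) × (PBond (F.P K) (K - J) → Matrix.specialUnitaryGroup (Fin 2) ℂ) =>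
      Function.extend (β (F.P K) (K - J)) q.2 q.1) ⁻¹' S ∈ 𝓝 (U₀, U₀ ∘ β (F.P K) (K - J)) := by
    refine hcont.continuousAt.preimage_mem_nhds ?_
    show S ∈ 𝓝 (Function.extend (β (F.P K) (K - J)) (U₀ ∘ β (F.P K) (K - J)) U₀)
    rw [extend_comp_self β]; exact hS
  have himg := image_mem_map (m := fun q : GaugeField (F.P K) 0 (Matrix.specialUnitaryGroup (Fin 2) ℂ) ×
      (PBond (F.P K) (K - J) → Matrix.specialUnitaryGroup (Fin 2) ℂ) =>
        (q.1, Averaging.iter (fun i => BlockAveraging.blockAvg (P := F.P K) (j := i) ℰp) (K - J) (Function.extend (β (F.P K) (K - J)) q.2 q.1))) hpre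
  rw [hmap, hW] at himg
  have hslice : {z : GaugeField (F.P K) 0 (Matrix.specialUnitaryGroup (Fin 2) ℂ) | (z, W) ∈
      (fun q : GaugeField (F.P K) 0 (Matrix.specialUnitaryGroup (Fin 2) ℂ) × (PBond (F.P K) (K - J) → Matrix.specialUnitaryGroup (Fin 2) ℂ) =>
        (q.1, Averaging.iter (fun i => BlockAveraging.blockAvg (P := F.P K) (j := i) ℰp) (K - J) (Function.extend (β (F.P K) (K - J)) q.2 q.1))) ''
      ((fun q => Function.extend (β (F.P K) (K - J)) q.2 q.1) ⁻¹' S)} ∈ 𝓝 U₀ :=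
    (continuous_id.prodMk continuous_const).continuousAt.preimage_mem_nhds himg
  haveI := isOpenPosMeasure_fieldMeasure_SU (N := 2) (F.P K) 0
  refine (Measure.measure_pos_of_mem_nhds (fieldMeasure (F.P K) 0 (Matrix.specialUnitaryGroup (Fin 2) ℂ)) hslice).trans_le (measure_mono ?_)
  rintro z ⟨⟨z', g⟩, hq, hzq⟩
  simp only [Prod.mk.injEq] at hzq
  obtain ⟨rfl, hiter⟩ := hzq
  exact ⟨g, hq, hiter⟩

end Charge

/-! ## §2 The window chart of WREG with its LOCAL CHARGE row (chart + recognition + §1) -/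

section Chart

/-- ★★★ **THE WINDOW CHART OF `D_{J,K}` ON `histGood(θBal b₀) K J` OVER THE OPEN WINDOW `{PlaqSmall θ_J}`, WITH ITS LOCAL CHARGE ROW.**  For every block size `L`
and profile `b₀, p₀ > 0` there is `γ₁ ∈ (0, 1]` such that for every family `F` (`F.L = L`), `0 < γ ≤ γ₁` and depth `J ≤ K` there is a window chart
`c : WindowChart F hJK (histGood F ℰp θ K J) {V | PlaqSmall (θ J) V}` (`θ = θBal F.L γ b₀ p₀`; the ✓`windowChartsExist_of_flat` construction `WindowChart.ofChartData` fed
by ✓`Wreg.chartVol ∕ edgeFlat ∕ levelFlat` and §1) whose fibres CHARGE EVERY NEIGHBOURHOOD OF EVERY GOOD FIBRE POINT: `∀ V ∈ O, ∀ x, D x = V → x ∈ histGood →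
∀ S ∈ 𝓝 x, S ⊆ histGood → 0 < dU_K {z | c.jac (V, z) ≠ 0 ∧ c.Φ (V, z) ∈ S}` (§1 + the RECOGNITION row `ChartData.recog`).
[cite: Balaban1987RG1, (0.4) p.253, (2.4) p.266 and (2.10) p.267; Balaban1985Averaging, (10) p.19] -/
theorem exists_windowChart_localCharge :
    ∀ (L : ℕ) (b₀ p₀ : ℝ), 0 < b₀ → 0 < p₀ → ∃ γ₁ : ℝ, 0 < γ₁ ∧ γ₁ ≤ 1 ∧ ∀ (F : T3Family) (γ : ℝ), F.L = L → 0 < γ → γ ≤ γ₁ →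
      ∀ (J K : ℕ) (hJK : J ≤ K),
        ∃ c : WindowChart F hJK (histGood F ℰp (θBal F.L γ b₀ p₀) K J)
            {V : GaugeField (F.P J) 0 (Matrix.specialUnitaryGroup (Fin 2) ℂ) | PlaqSmall (θBal F.L γ b₀ p₀ J) V},
          ∀ V : GaugeField (F.P J) 0 (Matrix.specialUnitaryGroup (Fin 2) ℂ), PlaqSmall (θBal F.L γ b₀ p₀ J) V →
            ∀ x : GaugeField (F.P K) 0 (Matrix.specialUnitaryGroup (Fin 2) ℂ), descendTo F ℰp J K hJK x = V →
              x ∈ histGood F ℰp (θBal F.L γ b₀ p₀) K J →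
              ∀ S : Set (GaugeField (F.P K) 0 (Matrix.specialUnitaryGroup (Fin 2) ℂ)), S ∈ 𝓝 x → S ⊆ histGood F ℰp (θBal F.L γ b₀ p₀) K J →
                0 < fieldMeasure (F.P K) 0 (Matrix.specialUnitaryGroup (Fin 2) ℂ) {z | c.jac (V, z) ≠ 0 ∧ c.Φ (V, z) ∈ S} := by
  intro L b₀ p₀ hb hp
  by_cases hL : 1 ≤ L
  swap
  · refine ⟨1, one_pos, le_rfl, fun F γ hFL _ _ => ?_⟩
    exact absurd (hFL ▸ F.hL.2.le) hL
  obtain ⟨δ', γ₁, hδ', hγ₁, hreg⟩ := exists_gamma_levelRegime L b₀ p₀ hb hp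
  obtain ⟨α, hα0, hα24, hα64, hαF⟩ := exists_chartRegime L hL
  set D₅ : ℝ := ((((3 + 2) * L : ℕ) : ℝ) ^ 2 / 4) with hD₅
  have hD₅0 : 0 ≤ D₅ := by positivity
  set σ : ℝ := α / (D₅ + 1) with hσ
  have hσ0 : 0 < σ := div_pos hα0 (by positivity)
  obtain ⟨γ₂, hγ₂, hγ₂1, hθσ⟩ := exists_gamma_forall_θBal_le (b₀ := b₀) (p₀ := p₀) hb hp hσ0
  refine ⟨min γ₁ γ₂, lt_min hγ₁ hγ₂, (min_le_right _ _).trans hγ₂1, fun F γ hFL hγ hγle J K hJK => ?_⟩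
  have hLF : 1 ≤ F.L := F.hL.2.le
  obtain ⟨hαL, hgap⟩ := hαF F hFL K
  obtain ⟨hsmall, hθlt⟩ := hreg F γ hFL hγ (hγle.trans (min_le_left _ _)) K
  have hγ1 : γ ≤ 1 := (hγle.trans (min_le_right _ _)).trans hγ₂1
  have hθpos : ∀ i, 0 < θBal F.L γ b₀ p₀ i := fun i => T3MinimiserStabilityReduction.θBal_pos hLF hγ hγ1 hb p₀ i
  have hθ0 : ∀ i, 0 ≤ θBal F.L γ b₀ p₀ i := fun i => (hθpos i).le
  have hθα : ∀ i, (((((F.P K).d + 2) * (F.P K).L : ℕ) : ℝ) ^ 2 / 4) * θBal F.L γ b₀ p₀ i ≤ α := by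
    intro i
    have hθi : θBal F.L γ b₀ p₀ i ≤ σ := hθσ F.L hLF γ hγ (hγle.trans (min_le_right _ _)) i
    have hd : (F.P K).d = 3 := T3Family.P_d F K
    have hLL : (F.P K).L = L := hFL
    rw [hd, hLL, ← hD₅]
    calc D₅ * θBal F.L γ b₀ p₀ i ≤ D₅ * σ := mul_le_mul_of_nonneg_left hθi hD₅0
      _ ≤ α := by
          rw [hσ, mul_div_assoc', div_le_iff₀ (by positivity)]
          nlinarith [hα0.le]
  have hn : K - J ≤ (F.P K).m + (F.P K).K := by
    show K - J ≤ F.m + K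
    omega
  have hβ := iterCentralBond_injective (P := F.P K) (n := K - J) hn
  set θ := θBal F.L γ b₀ p₀ with hθdef
  set O : Set (GaugeField (F.P J) 0 (Matrix.specialUnitaryGroup (Fin 2) ℂ)) := {V | PlaqSmall (θ J) V} with hOdef
  have hO : IsOpen O := isOpen_setOf_plaqSmall₂ (F.P J) 0 (θ J)
  obtain ⟨j₀, hj₀, hvol⟩ := chartVol F K α hα0 hα24 hα64 hαL hgap
  obtain ⟨D, hDb⟩ := exists_chartData_bdd F hJK hθ0 hα0.le hα24 hα64 hαL hgap hθα hj₀ hvol hO.measurableSet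
  have hs := F.sitesPerDir_eq (m := F.m) (K := J) (j := 0) (m' := F.m) (K' := K) (j' := K - J) (by omega)
  have hdesc : (descendTo F ℰp J K hJK : GaugeField (F.P K) 0 (Matrix.specialUnitaryGroup (Fin 2) ℂ) → GaugeField (F.P J) 0 _) =
      fieldShift hs ∘ Averaging.iter (fun i => BlockAveraging.blockAvg (P := F.P K) (j := i) ℰp) (K - J) := rfl
  have he'e : ∀ y : GaugeField (F.P K) (K - J) (Matrix.specialUnitaryGroup (Fin 2) ℂ), fieldShift hs.symm (fieldShift hs y) = y :=
    fieldShift_fieldShift_symm hs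
  have hee' : ∀ y' : GaugeField (F.P J) 0 (Matrix.specialUnitaryGroup (Fin 2) ℂ), fieldShift hs (fieldShift hs.symm y') = y' :=
    fieldShift_symm_fieldShift hs
  have hiter_of_desc : ∀ U V, descendTo F ℰp J K hJK U = V →
      Averaging.iter (fun i => BlockAveraging.blockAvg (P := F.P K) (j := i) ℰp) (K - J) U = fieldShift hs.symm V := by
    intro U V h
    rw [hdesc, Function.comp_apply] at h
    rw [← h, he'e]
  have hloc : ∀ V : GaugeField (F.P J) 0 (Matrix.specialUnitaryGroup (Fin 2) ℂ), ∀ x : GaugeField (F.P K) 0 (Matrix.specialUnitaryGroup (Fin 2) ℂ),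
      descendTo F ℰp J K hJK x = V → x ∈ histGood F ℰp θ K J →
      ∀ S : Set (GaugeField (F.P K) 0 (Matrix.specialUnitaryGroup (Fin 2) ℂ)), S ∈ 𝓝 x → S ⊆ histGood F ℰp θ K J →
        0 < fieldMeasure (F.P K) 0 (Matrix.specialUnitaryGroup (Fin 2) ℂ) {z | D.jac (V, z) ≠ 0 ∧ D.Φ (V, z) ∈ S} := by
    intro V x hxV hxgood S hS hSsub
    have hW := hiter_of_desc _ _ hxV
    have hpos := chartChargeNhds_holds (fun P n => iterCentralBond (P := P) n) (fun _ _ => rfl) (fun _ _ _ => rfl)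
      F K J θ α hθ0 hα0 hα24 hα64 hαL hθα (fieldShift hs.symm V) x hxgood hW S hS
    refine hpos.trans_le (measure_mono ?_)
    rintro z ⟨g, hgS, hgiter⟩
    have hUgood : Function.extend (iterCentralBond (K - J)) g z ∈ histGood F ℰp θ K J := hSsub hgS
    have hUiter : Averaging.iter (fun i => BlockAveraging.blockAvg (P := F.P K) (j := i) ℰp) (K - J)
        (Function.extend (iterCentralBond (K - J)) g z) = fieldShift hs.symm V := hgiter
    have hch : ∀ c, g c ∈ chainWindow (N := 2) α (K - J) z c := fun c => by
      have h := histGood_subset_charted F hJK hθ0 hθα hUgood c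
      rwa [hβ.extend_apply, chainWindow_extend α hn] at h
    have hd : descendTo F ℰp J K hJK (Function.extend (iterCentralBond (K - J)) g z) = V := by
      rw [hdesc, Function.comp_apply, hUiter, hee']
    obtain ⟨hJ, hΦ⟩ := D.recog V z g hch hUgood hd
    refine ⟨hJ, ?_⟩
    rw [hΦ]
    exact hgS
  refine ⟨WindowChart.ofChartData D hδ'.le hθlt hsmall _ hDb (fun V₁ _ => ?_) (fun V₁ hV₁ => ?_) (fun V₁ _ hpre => ?_),
    fun V _ x hxV hxgood S hS hSsub => hloc V x hxV hxgood S hS hSsub⟩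
  · have hae : ∀ c, ∀ᵐ z ∂fieldMeasure (F.P K) 0 (Matrix.specialUnitaryGroup (Fin 2) ℂ),
        V₁ (D.w c) ∉ frontier (chainMap ℰp (K - J) z c '' chainWindow (N := 2) α (K - J) z c) := fun c =>
      edgeFlat F K (K - J) hn α hα0 hα24 hα64 hαL hgap c (V₁ (D.w c))
    filter_upwards [ae_all_iff.2 hae] with z hz
    by_cases hT : ∀ c, V₁ (D.w c) ∈ D.T c z
    · refine Or.inl fun c => ?_
      rw [← self_sdiff_frontier]
      refine ⟨hT c, ?_⟩
      rw [D.T_eq]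
      exact hz c
    · simp only [not_forall] at hT
      obtain ⟨c, hc⟩ := hT
      exact Or.inr ⟨c, by rwa [(D.isClosed_T c z).closure_eq]⟩
  · have hae := levelFlat F K (K - J) hn α hα0 hα24 hα64 hαL hgap (fun j => θ (K - j)) (fun j => (hθpos _).ne') (fieldShift hs.symm V₁)
    filter_upwards [hae] with z hz hT j hj p
    obtain ⟨hoff, hwin, hd⟩ := D.charted V₁ z hT
    have h2 := hiter_of_desc _ _ hd
    rcases hj.lt_or_eq with hlt | rfl
    · exact hz (D.Φ (V₁, z)) hoff hwin h2 j hlt p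
    · rw [h2, Nat.sub_sub_self hJK]
      exact (lt_of_eq_of_lt (congrArg dist1 (plaqHol_fieldShift hs.symm V₁ p)) (hV₁ _)).ne
  · obtain ⟨U₀, hU₀V, hU₀int⟩ := hpre
    exact hloc V₁ U₀ hU₀V (interior_subset hU₀int) _ (Filter.mem_of_superset (isOpen_interior.mem_nhds hU₀int) interior_subset) Set.Subset.rfl

end Chart

/-! ## §3 ⟨HAAR-TUBE₁-REL⟩ at depth one, unconditionally (px8 g14's `hrel` letter of `…SmallMassOneStep.smallMassInterior_of_haarTubeRel_floor`, verbatim) -/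

section Tube

variable (F : T3Family)

/-- At depth one, a fine field whose own plaquettes are `θ_{J+1}`-small and whose one-step descent is `θ_J`-small is a UV-small history:
`x ∈ histGood F ℰp θ (J+1) J` (✓`mem_histGood_iff_descendTo`). [cite: Balaban1985UV3, (7) p.257] -/
theorem mem_histGood_succ_of (θ : ℕ → ℝ) {J : ℕ} {x : GaugeField (F.P (J + 1)) 0 (Matrix.specialUnitaryGroup (Fin 2) ℂ)}
    (htop : PlaqSmall (θ (J + 1)) x) (hbase : PlaqSmall (θ J) (descendTo F ℰp J (J + 1) (Nat.le_succ J) x)) :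
    x ∈ histGood F ℰp θ (J + 1) J := by
  rw [mem_histGood_iff_descendTo]
  intro j hJj hjK
  rcases hJj.eq_or_lt with rfl | hlt
  · exact hbase
  · obtain rfl : j = J + 1 := le_antisymm hjK hlt
    rw [plaqSmall_descendTo_iff, Nat.sub_self]
    exact htop

/-- A positive-measure live set inside the target makes the chart's target charge positive: `0 < ν{z | jac(V,z) ≠ 0 ∧ Φ(V,z) ∈ G}` ⇒
`0 < ∫⁻ 1_G(Φ(V,z))·jac(V,z) dν(z)` (for a measurable integrand). [folklore] -/
theorem lintegral_indicator_mul_pos {Z Y : Type*} [MeasurableSpace Z] (ν : Measure Z) {Φ : Z → Y} {jac : Z → ℝ≥0} {G : Set Y}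
    (hmeas : Measurable fun z => G.indicator (fun _ => (1 : ℝ≥0∞)) (Φ z) * (jac z : ℝ≥0∞))
    (hpos : 0 < ν {z | jac z ≠ 0 ∧ Φ z ∈ G}) :
    0 < ∫⁻ z, G.indicator (fun _ => (1 : ℝ≥0∞)) (Φ z) * (jac z : ℝ≥0∞) ∂ν := by
  rw [lintegral_pos_iff_support hmeas]
  refine hpos.trans_le (measure_mono ?_)
  rintro z ⟨hj, hG⟩
  rw [Function.mem_support, Set.indicator_of_mem hG, one_mul]
  exact_mod_cast hj

/-- ★★★ **⟨HAAR-TUBE₁-REL⟩ AT DEPTH ONE, UNCONDITIONALLY** — px8 g14's `hrel` letter of `…SmallMassOneStep.smallMassInterior_of_haarTubeRel_floor`, VERBATIM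
(`c₀ = 1∕2`, `pS = 0`): for every MEASURABLE section `σ` of the one-step descent over `W_J(c·b₀)` WITH MARGIN (`D (σ U) = U`, `PlaqSmall (θ_{J+1}(c·b₀) − 4r) (σ U)`;
GEOM∘ ✓`interiorSectionCan` supplies such) ONE fraction `q₁ > 0` gives `ofReal q₁ · dU_{J+1}(D⁻¹B ∩ histGood(θBal b₀) (J+1) J) ≤ dU_{J+1}(D⁻¹B ∩ histGood(θBal b₀) (J+1) J ∩
{V | ∀ b, dist1 ((σ (D V) b)⁻¹ · V b) < r})` for every measurable `B ⊆ W_J(c·b₀)`.  PROOF: §2's chart on `Sfine = histGood(θBal b₀) (J+1) J` over `O = {PlaqSmall θ_J(b₀)}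
⊇ W_J(c·b₀)` (✓`θBal_mul`); the pairs `(U, σ U)` lie in the compact `P = {(D x, x) | plaq x ≤ θ_{J+1}(c b₀) − 4r, plaq (D x) ≤ θ_J(c b₀)}` (`D` continuous on the small
class, ✓`FibrePositivity.continuousOn_blockAvg_expMeanLogSU`); each such `x` is a good fibre point with open neighbourhood `Sfine ∩ tube_r(x)` (✓`isOpen_histGood`,
✓`isOpen_linkTube`), charged by §2; ✓`hfib_of_pos` (w4-20520 g18) gives one `q₁` on `P`, ✓`haarTube_oneStep_of_windowChart` (px8 g14) integrates.  `q₁` depends on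
`(F, γ, J, c, r)` only.  [cite: Balaban1985Averaging, (10) p.19 and Prop. 1 p.22; Balaban1987RG1, (0.4) p.253 and (2.10) p.267; Balaban1985UV3, (7) p.257 and (38)-(40) p.266] -/
theorem haarTubeRel_depthOne :
    ∀ (L : ℕ), ∃ c₀ : ℝ, 0 < c₀ ∧ c₀ ≤ 1 ∧ ∀ (c : ℝ), 0 < c → c ≤ c₀ → ∃ pS : ℝ, ∀ (b₀ p₀ : ℝ), 0 < b₀ → pS ≤ p₀ → 0 < p₀ →
      ∃ γ₁ : ℝ, 0 < γ₁ ∧ ∀ (F : T3Family) (γ : ℝ), F.L = L → 0 < γ → γ ≤ γ₁ →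
        ∀ (J : ℕ) (r : ℝ), 0 < r →
          ∀ σ : GaugeField (F.P J) 0 (Matrix.specialUnitaryGroup (Fin 2) ℂ) → GaugeField (F.P (J + 1)) 0 (Matrix.specialUnitaryGroup (Fin 2) ℂ),
            Measurable σ →
            (∀ U : GaugeField (F.P J) 0 (Matrix.specialUnitaryGroup (Fin 2) ℂ), PlaqSmall (θBal F.L γ (c * b₀) p₀ J) U →
              descendTo F ℰp J (J + 1) (Nat.le_succ J) (σ U) = U ∧ PlaqSmall (θBal F.L γ (c * b₀) p₀ (J + 1) - 4 * r) (σ U)) →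
            ∃ q₁ : ℝ, 0 < q₁ ∧ ∀ (B : Set (GaugeField (F.P J) 0 (Matrix.specialUnitaryGroup (Fin 2) ℂ))), MeasurableSet B →
              B ⊆ {U | PlaqSmall (θBal F.L γ (c * b₀) p₀ J) U} →
              ENNReal.ofReal q₁ * fieldMeasure (F.P (J + 1)) 0 (Matrix.specialUnitaryGroup (Fin 2) ℂ)
                  (descendTo F ℰp J (J + 1) (Nat.le_succ J) ⁻¹' B ∩ histGood F ℰp (θBal F.L γ b₀ p₀) (J + 1) J) ≤
                fieldMeasure (F.P (J + 1)) 0 (Matrix.specialUnitaryGroup (Fin 2) ℂ)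
                  (descendTo F ℰp J (J + 1) (Nat.le_succ J) ⁻¹' B ∩ histGood F ℰp (θBal F.L γ b₀ p₀) (J + 1) J ∩
                    {V | ∀ b : PBond (F.P (J + 1)) 0, dist1 ((σ (descendTo F ℰp J (J + 1) (Nat.le_succ J) V) b)⁻¹ * V b) < r}) := by
  intro L
  refine ⟨1 / 2, by norm_num, by norm_num, fun c hc hcle => ⟨0, fun b₀ p₀ hb₀ _ hp₀ => ?_⟩⟩
  obtain ⟨γA, hγA, hγA1, hA⟩ := exists_windowChart_localCharge L b₀ p₀ hb₀ hp₀
  obtain ⟨δ', γB, hδ', hγB, hB⟩ := exists_gamma_levelRegime L b₀ p₀ hb₀ hp₀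
  refine ⟨min γA γB, lt_min hγA hγB, fun F γ hFL hγ hγle J r hr σ _ hσ => ?_⟩
  have hγA' : γ ≤ γA := hγle.trans (min_le_left _ _)
  have hγB' : γ ≤ γB := hγle.trans (min_le_right _ _)
  have hLF : 1 ≤ F.L := F.hL.2.le
  have hγ1 : γ ≤ 1 := hγA'.trans hγA1
  obtain ⟨hsmall, hθlt⟩ := hB F γ hFL hγ hγB' (J + 1)
  set θ := θBal F.L γ b₀ p₀ with hθdef
  have hθpos : ∀ i, 0 < θ i := fun i => T3MinimiserStabilityReduction.θBal_pos hLF hγ hγ1 hb₀ p₀ i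
  have hθc : ∀ i, θBal F.L γ (c * b₀) p₀ i < θ i := fun i => by
    rw [hθdef, θBal_mul]
    exact mul_lt_of_lt_one_left (hθpos i) (by linarith)
  set Sfine := histGood F ℰp θ (J + 1) J with hSdef
  set O : Set (GaugeField (F.P J) 0 (Matrix.specialUnitaryGroup (Fin 2) ℂ)) := {V | PlaqSmall (θ J) V} with hOdef
  have hO : IsOpen O := isOpen_setOf_plaqSmall₂ (F.P J) 0 (θ J)
  have hSm : MeasurableSet Sfine := measurableSet_histGood F ℰp measurableE_ℰp θ (J + 1) J
  have hSo : IsOpen Sfine := isOpen_histGood F hδ'.le (fun i => (hθlt i).le) hsmall (Nat.le_succ J)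
  set W : Set (GaugeField (F.P J) 0 (Matrix.specialUnitaryGroup (Fin 2) ℂ)) := {U | PlaqSmall (θBal F.L γ (c * b₀) p₀ J) U} with hWdef
  have hWO : W ⊆ O := fun U hU p => (hU p).trans (hθc J)
  obtain ⟨ch, hloc⟩ := hA F γ hFL hγ hγA' J (J + 1) (Nat.le_succ J)
  have hs := F.sitesPerDir_eq (m := F.m) (K := J) (j := 0) (m' := F.m) (K' := J + 1) (j' := J + 1 - J) (by omega)
  have hDcont : ContinuousOn (descendTo F ℰp J (J + 1) (Nat.le_succ J))
      {x : GaugeField (F.P (J + 1)) 0 (Matrix.specialUnitaryGroup (Fin 2) ℂ) | PlaqSmall δ' x} := by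
    have hfs : Continuous (fieldShift (G := Matrix.specialUnitaryGroup (Fin 2) ℂ) hs) := continuous_pi fun _ => continuous_apply _
    have havg := Summit.QuantumFields.YangMills.Theorems.FibrePositivity.continuousOn_blockAvg_expMeanLogSU (P := F.P (J + 1)) (j := 0) (n := Fin 2)
      hδ'.le hsmall
    have hiter : ContinuousOn (Averaging.iter (fun i => BlockAveraging.blockAvg (P := F.P (J + 1)) (j := i) ℰp) (J + 1 - J))
        {x : GaugeField (F.P (J + 1)) 0 (Matrix.specialUnitaryGroup (Fin 2) ℂ) | PlaqSmall δ' x} := by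
      rw [Nat.add_sub_cancel_left]
      exact havg
    exact hfs.comp_continuousOn hiter
  set C₁ : Set (GaugeField (F.P (J + 1)) 0 (Matrix.specialUnitaryGroup (Fin 2) ℂ)) :=
    {x | ∀ p, dist1 (GaugeField.plaqHol x p) ≤ θBal F.L γ (c * b₀) p₀ (J + 1) - 4 * r} with hC₁def
  set C₂ : Set (GaugeField (F.P J) 0 (Matrix.specialUnitaryGroup (Fin 2) ℂ)) := {V | ∀ p, dist1 (GaugeField.plaqHol V p) ≤ θBal F.L γ (c * b₀) p₀ J} with hC₂def
  have hC₁δ : C₁ ⊆ {x | PlaqSmall δ' x} := fun x hx p => (hx p).trans_lt (by linarith [hθc (J + 1), hθlt (J + 1)])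
  have hDC : ContinuousOn (descendTo F ℰp J (J + 1) (Nat.le_succ J)) C₁ := hDcont.mono hC₁δ
  have hCcpt : IsCompact (C₁ ∩ descendTo F ℰp J (J + 1) (Nat.le_succ J) ⁻¹' C₂) :=
    (hDC.preimage_isClosed_of_isClosed (Summit.QuantumFields.YangMills.BalabanUVNodes.N07DirectMethod.isClosed_plaqLe (N := 2) _)
      (Summit.QuantumFields.YangMills.BalabanUVNodes.N07DirectMethod.isClosed_plaqLe (N := 2) _)).isCompact
  set P : Set (GaugeField (F.P J) 0 (Matrix.specialUnitaryGroup (Fin 2) ℂ) × GaugeField (F.P (J + 1)) 0 (Matrix.specialUnitaryGroup (Fin 2) ℂ)) :=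
    (fun x => (descendTo F ℰp J (J + 1) (Nat.le_succ J) x, x)) '' (C₁ ∩ descendTo F ℰp J (J + 1) (Nat.le_succ J) ⁻¹' C₂) with hPdef
  have hP : IsCompact P := hCcpt.image_of_continuousOn ((hDC.mono Set.inter_subset_left).prodMk continuousOn_id)
  have hPO : P ⊆ O ×ˢ Set.univ := by
    rintro _ ⟨x, hx, rfl⟩
    exact ⟨fun p => (hx.2 p).trans_lt (hθc J), Set.mem_univ _⟩
  have hpos : ∀ p ∈ P, 0 < ∫⁻ z, (Sfine ∩ {V : GaugeField (F.P (J + 1)) 0 (Matrix.specialUnitaryGroup (Fin 2) ℂ) |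
      ∀ b : PBond (F.P (J + 1)) 0, dist1 ((p.2 b)⁻¹ * V b) < r}).indicator (fun _ => (1 : ℝ≥0∞)) (ch.Φ (p.1, z)) * (ch.jac (p.1, z) : ℝ≥0∞)
        ∂(fieldMeasure (F.P (J + 1)) 0 (Matrix.specialUnitaryGroup (Fin 2) ℂ)) := by
    rintro _ ⟨x, hx, rfl⟩
    dsimp only
    have hxtop : PlaqSmall (θ (J + 1)) x := fun p => (hx.1 p).trans_lt (by linarith [hθc (J + 1)])
    have hxbase : PlaqSmall (θ J) (descendTo F ℰp J (J + 1) (Nat.le_succ J) x) := fun p => (hx.2 p).trans_lt (hθc J)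
    have hxS : x ∈ Sfine := mem_histGood_succ_of F θ hxtop hxbase
    have hxT : x ∈ {V : GaugeField (F.P (J + 1)) 0 (Matrix.specialUnitaryGroup (Fin 2) ℂ) | ∀ b : PBond (F.P (J + 1)) 0, dist1 ((x b)⁻¹ * V b) < r} := by
      intro b
      rw [inv_mul_cancel, GaugeGroup.dist1_one]
      exact hr
    have hN : Sfine ∩ {V : GaugeField (F.P (J + 1)) 0 (Matrix.specialUnitaryGroup (Fin 2) ℂ) | ∀ b : PBond (F.P (J + 1)) 0, dist1 ((x b)⁻¹ * V b) < r} ∈ 𝓝 x :=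
      (hSo.inter (isOpen_linkTube x r)).mem_nhds ⟨hxS, hxT⟩
    have hlocx : 0 < fieldMeasure (F.P (J + 1)) 0 (Matrix.specialUnitaryGroup (Fin 2) ℂ)
        {z | ch.jac (descendTo F ℰp J (J + 1) (Nat.le_succ J) x, z) ≠ 0 ∧ ch.Φ (descendTo F ℰp J (J + 1) (Nat.le_succ J) x, z) ∈
          Sfine ∩ {V : GaugeField (F.P (J + 1)) 0 (Matrix.specialUnitaryGroup (Fin 2) ℂ) | ∀ b : PBond (F.P (J + 1)) 0, dist1 ((x b)⁻¹ * V b) < r}} :=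
      hloc _ hxbase x rfl hxS _ hN Set.inter_subset_left
    exact lintegral_indicator_mul_pos (Φ := fun z => ch.Φ (descendTo F ℰp J (J + 1) (Nat.le_succ J) x, z))
      (jac := fun z => ch.jac (descendTo F ℰp J (J + 1) (Nat.le_succ J) x, z)) _
      (measurable_tubeIntegrand F (Nat.le_succ J) ch hSm r (descendTo F ℰp J (J + 1) (Nat.le_succ J) x, x)) hlocx
  have hσP : ∀ U ∈ O ∩ W, (U, σ U) ∈ P := by
    intro U hU
    obtain ⟨hDσ, hσsmall⟩ := hσ U hU.2
    refine ⟨σ U, ⟨fun p => (hσsmall p).le, ?_⟩, ?_⟩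
    · show ∀ p, dist1 (GaugeField.plaqHol (descendTo F ℰp J (J + 1) (Nat.le_succ J) (σ U)) p) ≤ θBal F.L γ (c * b₀) p₀ J
      rw [hDσ]
      exact fun p => (hU.2 p).le
    · show (descendTo F ℰp J (J + 1) (Nat.le_succ J) (σ U), σ U) = (U, σ U)
      rw [hDσ]
  obtain ⟨q, hq, hfib⟩ := hfib_of_pos F (Nat.le_succ J) ch hSm r hP hPO hpos σ W hσP
  refine ⟨q, hq, fun B hB hBW => ?_⟩
  exact haarTube_oneStep_of_windowChart F ch hO hSm σ r W hfib B hB (fun U hUB => ⟨hWO (hBW hUB), hBW hUB⟩)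

end Tube

end Summit.QuantumFields.YangMills.Theorems.FluctuationComparisonRegPrIntLHaarTubeLocalCharge

end
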